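import Literature.Geometry.MetricGeometry.GromovHausdorffApprox
import Literature.Geometry.MetricGeometry.CompactIsometryGroup
import Mathlib.Order.Filter.Ultrafilter.Basic
import HarnessLib

/-!
# Equivariant Gromov–Hausdorff limits: the limit group (Fukaya–Yamaguchi), compact case

Huang–Huang–Wang–Zhu 2026, Thm 2.1 (quoting Fukaya 1986 and Fukaya–Yamaguchi 1992, Prop. 3.6):
"Let `(Xᵢ, pᵢ)` be a sequence of metric spaces converging to a limit space `(X, p)` in the pointed
Gromov–Hausdorff sense. For each `i`, let `Gᵢ` be a closed subgroup of `Isom(Xᵢ)`. Then passing to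
a subsequence if necessary, `(Xᵢ, pᵢ, Gᵢ) → (X, p, G)`, where `G` is a closed subgroup of
`Isom(X)`. Moreover, the quotient spaces `(Xᵢ/Gᵢ, p̄ᵢ)` pointed Gromov–Hausdorff converge to
`(X/G, p̄)`." This is the engine of every limiting argument in the printed proof of their Main
Theorem 1 (§4 pp. 13–14, vendored as
`Literature.Geometry.Riemannian.huangHuangWangZhu2026_fibresOverCircle_four`): the limits
`(M̂ᵢ, p̂ᵢ, Hᵢ) → (ℝˢ × Ŷ, ·, H)`, `(τᵢ⁻¹(Mᵢ), p̄ᵢ, Kᵢ) → (X̄, p̄, K)`, and Lemma 6.1.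

This file PROVES the theorem in the absolute (unpointed) form adequate for compact spaces — which
covers the second and third displayed limits above, all of whose spaces have diameter `< 5nD` — and
for arbitrary groups `Γᵢ` acting isometrically on pseudometric spaces `Yᵢ` (closedness of `Gᵢ` is
not needed for the conclusion). The pointed version for proper spaces is not treated.

THE CONSTRUCTION (ultralimits). Fix `εᵢ`-approximations `fᵢ : Yᵢ → X` of a compact metric space
`X`, `εᵢ → 0`, quasi-inverses `qᵢ` (§2), and a free ultrafilter `𝒰` on `ℕ`.
* §2 TRANSPORT: `g ∈ Γᵢ` acts on `X` up to `4εᵢ` by `Tᵢ(g) = fᵢ ∘ g ∘ qᵢ`.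
* §3 LIMIT ISOMETRY of a thread `g = (gᵢ ∈ Γᵢ)ᵢ`: `L(g) x = 𝒰-lim Tᵢ(gᵢ) x` is an isometry of `X`
  (onto, by `Isometry.surjective_of_compactSpace`), and `Tᵢ(gᵢ) → L(g)` UNIFORMLY along `𝒰`
  (`eventually_forall_dist_transport_limitMap_le`: finite net + rough equicontinuity).
* §4 LIMIT GROUP `G = {L(g)} ≤ Isom(X)`: `L(1) = 1`, `L(g g') = L(g) L(g')`, `L(g⁻¹) = L(g)⁻¹`;
  limits of abelian actions are abelian (`limitGroup_mul_comm`; HHWZ p. 13 "H is Abelian").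
* §5 `G` = the set of isometries uniformly approximable by transported elements along `𝒰`
  (`mem_limitGroup_iff_isApproximable`, via a `Nat.findGreatest` diagonal choice), hence `G` is
  CLOSED for uniform convergence (`isClosed_image_toBCF_limitGroup`, in `X →ᵇ X`).
* §6 for `𝒰`-a.e. `i`: every `Tᵢ(g)`, `g ∈ Γᵢ`, is uniformly `δ`-close to `G` (ultrafilter
  dichotomy + §3), and every element of `G` is uniformly `δ`-close to some `Tᵢ(g)` (finite net of
  `G`, which is totally bounded inside the compact `isometrySet X` of
  `Literature.Geometry.MetricGeometry.isCompact_isometrySet`).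
* §7 hence for every `δ > 0`, for `𝒰`-a.e. `i`, `(fᵢ, φᵢ, ψᵢ)` is a `δ`-equivariant GH approximation
  `(Yᵢ, Γᵢ) → (X, G)` (`eventually_exists_isEquivGHApprox`), and along a subsequence
  (`exists_strictMono_isEquivGHApprox`, `Filter.extraction_forall_of_frequently`).
* §8 THE THEOREM in classical form from `εᵢ → 0` along `atTop`
  (`exists_subgroup_strictMono_isEquivGHApprox`, using the hyperfilter), and the "Moreover":
  the orbit spaces `Yᵢ/Γᵢ → X/G` (`exists_subgroup_strictMono_isGHApprox_orbitMap`, by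
  `IsEquivGHApprox.isGHApprox_orbitMap`).
The tautological isometric action of `X ≃ᵢ X` (and its subgroups) on `X` is registered in
`Literature/Geometry/MetricGeometry/Submetry.lean` §4; §1 here is bookkeeping on `𝒰`-limits in a
compact space (`Filter.limUnder`).

Everything here is a definition with body or a proved theorem; no named facts.

## References

* K. Fukaya, *Theory of convergence for Riemannian orbifolds*, Japan. J. Math. 12 (1986) 121–160.
* K. Fukaya, T. Yamaguchi, *The fundamental groups of almost nonnegatively curved manifolds*,
  Ann. of Math. 136 (1992) 253–333, §3, Prop. 3.6.
* H. Huang, X.-T. Huang, J. Wang, X. Zhu, arXiv:2605.24380 (2026), §2.1 Thm 2.1; §4 pp. 13–14.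
  [HuangHuangWangZhu2026]
-/

noncomputable section

open Metric Set Filter BoundedContinuousFunction

open scoped Topology

namespace Literature.Geometry.MetricGeometry

/-! ### §1. Ultralimits of sequences in a compact metric space -/

section Ulim

variable {X : Type*} [MetricSpace X] [CompactSpace X] [Nonempty X] (𝒰 : Ultrafilter ℕ)

omit [Nonempty X] in
/-- Along an ultrafilter every sequence in a compact space converges. [folklore] -/
theorem exists_tendsto_ultrafilter (u : ℕ → X) : ∃ x : X, Tendsto u (𝒰 : Filter ℕ) (𝓝 x) := by
  obtain ⟨x, -, hx⟩ :=
    (isCompact_univ (X := X)).ultrafilter_le_nhds (𝒰.map u) (le_principal_iff.mpr univ_mem)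
  exact ⟨x, hx⟩

/-- The `𝒰`-limit of a sequence in a nonempty compact metric space. [folklore] -/
def ulim (u : ℕ → X) : X :=
  limUnder (𝒰 : Filter ℕ) u

/-- The sequence converges to its `𝒰`-limit along `𝒰`. [folklore] -/
theorem tendsto_ulim (u : ℕ → X) : Tendsto u (𝒰 : Filter ℕ) (𝓝 (ulim 𝒰 u)) :=
  tendsto_nhds_limUnder (exists_tendsto_ultrafilter 𝒰 u)

variable {𝒰}

/-- Uniqueness of the `𝒰`-limit. [folklore] -/
theorem ulim_eq_of_tendsto {u : ℕ → X} {x : X} (h : Tendsto u (𝒰 : Filter ℕ) (𝓝 x)) :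
    ulim 𝒰 u = x :=
  tendsto_nhds_unique (tendsto_ulim 𝒰 u) h

variable (𝒰) in
/-- Distances pass to the `𝒰`-limit. [folklore] -/
theorem tendsto_dist_ulim (u v : ℕ → X) :
    Tendsto (fun i ↦ dist (u i) (v i)) (𝒰 : Filter ℕ) (𝓝 (dist (ulim 𝒰 u) (ulim 𝒰 v))) :=
  (tendsto_ulim 𝒰 u).dist (tendsto_ulim 𝒰 v)

/-- An eventual bound `d(uᵢ, vᵢ) ≤ cᵢ` with `cᵢ → C` gives `d(lim u, lim v) ≤ C`. [folklore] -/
theorem dist_ulim_le {u v : ℕ → X} {c : ℕ → ℝ} {C : ℝ} (hc : Tendsto c (𝒰 : Filter ℕ) (𝓝 C))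
    (h : ∀ᶠ i in (𝒰 : Filter ℕ), dist (u i) (v i) ≤ c i) : dist (ulim 𝒰 u) (ulim 𝒰 v) ≤ C :=
  le_of_tendsto_of_tendsto (tendsto_dist_ulim 𝒰 u v) hc h

/-- Sequences at vanishing distance have the same `𝒰`-limit. [folklore] -/
theorem ulim_eq_ulim_of_tendsto {u v : ℕ → X}
    (h : Tendsto (fun i ↦ dist (u i) (v i)) (𝒰 : Filter ℕ) (𝓝 0)) : ulim 𝒰 u = ulim 𝒰 v :=
  dist_eq_zero.mp (tendsto_nhds_unique (tendsto_dist_ulim 𝒰 u v) h)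

variable (𝒰) in
/-- `d(uᵢ, lim u) < δ` for `𝒰`-almost every `i`. [folklore] -/
theorem eventually_dist_ulim_lt (u : ℕ → X) {δ : ℝ} (hδ : 0 < δ) :
    ∀ᶠ i in (𝒰 : Filter ℕ), dist (u i) (ulim 𝒰 u) < δ :=
  Metric.tendsto_nhds.mp (tendsto_ulim 𝒰 u) δ hδ

/-- A nonnegative real sequence eventually below every `δ > 0` tends to `0`. [folklore] -/
theorem tendsto_zero_of_forall_eventually_le {l : Filter ℕ} {a : ℕ → ℝ} (h0 : ∀ i, 0 ≤ a i)
    (h : ∀ δ : ℝ, 0 < δ → ∀ᶠ i in l, a i ≤ δ) : Tendsto a l (𝓝 0) := by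
  rw [Metric.tendsto_nhds]
  intro δ hδ
  filter_upwards [h (δ / 2) (half_pos hδ)] with i hi
  rw [Real.dist_eq, sub_zero, abs_of_nonneg (h0 i)]
  linarith

/-- If `cᵢ → 0` and `0 < δ` then eventually `k * cᵢ < δ`. [folklore] -/
theorem eventually_const_mul_lt {l : Filter ℕ} {c : ℕ → ℝ} (hc : Tendsto c l (𝓝 0)) (k : ℝ)
    {δ : ℝ} (hδ : 0 < δ) : ∀ᶠ i in l, k * c i < δ := by
  have h : Tendsto (fun i ↦ k * c i) l (𝓝 0) := by simpa using hc.const_mul k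
  exact (tendsto_order.mp h).2 δ hδ

end Ulim

/-! ### §2. The setting: approximations `fᵢ : Yᵢ → X` of a compact space; transported actions -/

section Transport

variable {X : Type*} [MetricSpace X] {Y : ℕ → Type*} [∀ i, PseudoMetricSpace (Y i)]
  {Γ : ℕ → Type*} [∀ i, Group (Γ i)] [∀ i, MulAction (Γ i) (Y i)] {ε : ℕ → ℝ} {f : ∀ i, Y i → X}

/-- Chosen quasi-inverses `qᵢ : X → Yᵢ` of the approximations `fᵢ`
(`IsGHApprox.exists_quasiInverse`). [folklore] -/
def qinv (hf : ∀ i, IsGHApprox (ε i) (f i)) (i : ℕ) : X → Y i :=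
  Classical.choose (hf i).exists_quasiInverse

/-- The defining properties of the quasi-inverses: `qᵢ` is a `3εᵢ`-approximation,
`d(qᵢ (fᵢ y), y) ≤ 2εᵢ`, `d(fᵢ (qᵢ x), x) ≤ εᵢ`. [folklore] -/
theorem qinv_spec (hf : ∀ i, IsGHApprox (ε i) (f i)) (i : ℕ) :
    IsGHApprox (3 * ε i) (qinv hf i) ∧ (∀ y : Y i, dist (qinv hf i (f i y)) y ≤ 2 * ε i) ∧
      ∀ x : X, dist (f i (qinv hf i x)) x ≤ ε i :=
  Classical.choose_spec (hf i).exists_quasiInverse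

/-- The constants `εᵢ` are nonnegative (when the target `X` is nonempty). [folklore] -/
theorem eps_nonneg [Nonempty X] (hf : ∀ i, IsGHApprox (ε i) (f i)) (i : ℕ) : 0 ≤ ε i :=
  (hf i).nonneg' (Classical.arbitrary X)

/-- TRANSPORT of a group element `g ∈ Γᵢ` to a rough self-map of `X`:
`Tᵢ(g) = fᵢ ∘ g ∘ qᵢ`. [folklore] -/
def transport (hf : ∀ i, IsGHApprox (ε i) (f i)) (i : ℕ) (g : Γ i) (x : X) : X :=
  f i (g • qinv hf i x)

/-- Unfolding lemma for `transport`. [folklore] -/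
theorem transport_apply (hf : ∀ i, IsGHApprox (ε i) (f i)) (i : ℕ) (g : Γ i) (x : X) :
    transport hf i g x = f i (g • qinv hf i x) :=
  rfl

/-- `Tᵢ(1)` is `εᵢ`-close to the identity. [folklore] -/
theorem dist_transport_one_le (hf : ∀ i, IsGHApprox (ε i) (f i)) (i : ℕ) (x : X) :
    dist (transport hf i (1 : Γ i) x) x ≤ ε i := by
  rw [transport_apply, one_smul]
  exact (qinv_spec hf i).2.2 x

variable [∀ i, IsIsometricSMul (Γ i) (Y i)]

/-- `Tᵢ(g)` increases distances by at most `4εᵢ`. [folklore] -/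
theorem dist_transport_le (hf : ∀ i, IsGHApprox (ε i) (f i)) (i : ℕ) (g : Γ i) (x x' : X) :
    dist (transport hf i g x) (transport hf i g x') ≤ dist x x' + 4 * ε i := by
  rw [transport_apply, transport_apply]
  calc dist (f i (g • qinv hf i x)) (f i (g • qinv hf i x'))
      ≤ dist (g • qinv hf i x) (g • qinv hf i x') + ε i := (hf i).dist_le _ _
    _ = dist (qinv hf i x) (qinv hf i x') + ε i := by rw [dist_smul]
    _ ≤ (dist x x' + 3 * ε i) + ε i := by gcongr; exact (qinv_spec hf i).1.dist_le _ _
    _ = dist x x' + 4 * ε i := by ring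

/-- `Tᵢ(g)` decreases distances by at most `4εᵢ`. [folklore] -/
theorem le_dist_transport (hf : ∀ i, IsGHApprox (ε i) (f i)) (i : ℕ) (g : Γ i) (x x' : X) :
    dist x x' ≤ dist (transport hf i g x) (transport hf i g x') + 4 * ε i := by
  rw [transport_apply, transport_apply]
  calc dist x x' ≤ dist (qinv hf i x) (qinv hf i x') + 3 * ε i := (qinv_spec hf i).1.le_dist_add _ _
    _ = dist (g • qinv hf i x) (g • qinv hf i x') + 3 * ε i := by rw [dist_smul]
    _ ≤ (dist (f i (g • qinv hf i x)) (f i (g • qinv hf i x')) + ε i) + 3 * ε i := by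
        gcongr; exact (hf i).le_dist_add _ _
    _ = _ := by ring

/-- `Tᵢ(g g')` is `3εᵢ`-close to `Tᵢ(g) ∘ Tᵢ(g')`. [folklore] -/
theorem dist_transport_mul_le (hf : ∀ i, IsGHApprox (ε i) (f i)) (i : ℕ) (g g' : Γ i) (x : X) :
    dist (transport hf i (g * g') x) (transport hf i g (transport hf i g' x)) ≤ 3 * ε i := by
  simp only [transport_apply]
  calc dist (f i ((g * g') • qinv hf i x)) (f i (g • qinv hf i (f i (g' • qinv hf i x))))
      ≤ dist ((g * g') • qinv hf i x) (g • qinv hf i (f i (g' • qinv hf i x))) + ε i :=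
        (hf i).dist_le _ _
    _ = dist (g' • qinv hf i x) (qinv hf i (f i (g' • qinv hf i x))) + ε i := by
        rw [mul_smul, dist_smul]
    _ ≤ 2 * ε i + ε i := by
        gcongr
        rw [dist_comm]
        exact (qinv_spec hf i).2.1 _
    _ = 3 * ε i := by ring

/-- `Tᵢ(g) (fᵢ y)` is `3εᵢ`-close to `fᵢ (g • y)`: transported elements almost commute with `fᵢ`.
[folklore] -/
theorem dist_transport_map_le (hf : ∀ i, IsGHApprox (ε i) (f i)) (i : ℕ) (g : Γ i) (y : Y i) :
    dist (transport hf i g (f i y)) (f i (g • y)) ≤ 3 * ε i := by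
  rw [transport_apply]
  calc dist (f i (g • qinv hf i (f i y))) (f i (g • y))
      ≤ dist (g • qinv hf i (f i y)) (g • y) + ε i := (hf i).dist_le _ _
    _ = dist (qinv hf i (f i y)) y + ε i := by rw [dist_smul]
    _ ≤ 2 * ε i + ε i := by gcongr; exact (qinv_spec hf i).2.1 y
    _ = 3 * ε i := by ring

/-! ### §3. The limit isometry of a thread `(gᵢ)ᵢ`, `gᵢ ∈ Γᵢ` -/

variable [CompactSpace X] [Nonempty X] (𝒰 : Ultrafilter ℕ) (hf : ∀ i, IsGHApprox (ε i) (f i))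
  (hε : Tendsto ε (𝒰 : Filter ℕ) (𝓝 0))

/-- The limit self-map of `X` defined by a thread `g = (gᵢ)ᵢ`: `x ↦ 𝒰-lim Tᵢ(gᵢ)(x)`. [folklore] -/
def limitFun (g : ∀ i, Γ i) (x : X) : X :=
  ulim 𝒰 fun i ↦ transport hf i (g i) x

omit [∀ i, IsIsometricSMul (Γ i) (Y i)] [CompactSpace X] in
/-- Unfolding lemma for `limitFun`. [folklore] -/
theorem limitFun_apply (g : ∀ i, Γ i) (x : X) :
    limitFun 𝒰 hf g x = ulim 𝒰 fun i ↦ transport hf i (g i) x :=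
  rfl

include hε in
/-- The limit self-map of a thread is an isometry (the distortions `4εᵢ` vanish in the limit).
[folklore] -/
theorem isometry_limitFun (g : ∀ i, Γ i) : Isometry (limitFun 𝒰 hf g) := by
  refine Isometry.of_dist_eq fun x x' ↦ ?_
  have h1 := tendsto_dist_ulim 𝒰 (fun i ↦ transport hf i (g i) x) fun i ↦ transport hf i (g i) x'
  have h2 : Tendsto (fun i ↦ dist (transport hf i (g i) x) (transport hf i (g i) x')) (𝒰 : Filter ℕ)
      (𝓝 (dist x x')) := by
    have h4 : Tendsto (fun i ↦ 4 * ε i) (𝒰 : Filter ℕ) (𝓝 0) := by simpa using hε.const_mul 4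
    have h3 : Tendsto (fun i ↦ dist (transport hf i (g i) x) (transport hf i (g i) x') - dist x x')
        (𝒰 : Filter ℕ) (𝓝 0) := by
      refine squeeze_zero_norm' (Eventually.of_forall fun i ↦ ?_) h4
      rw [Real.norm_eq_abs, abs_le]
      constructor <;>
        linarith [dist_transport_le hf i (g i) x x', le_dist_transport hf i (g i) x x']
    simpa using h3.add_const (dist x x')
  exact tendsto_nhds_unique h1 h2

/-- THE LIMIT ISOMETRY `L(g) ∈ Isom(X)` of a thread `g = (gᵢ ∈ Γᵢ)ᵢ` (surjective by
`Isometry.surjective_of_compactSpace`). [folklore] -/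
def limitMap (g : ∀ i, Γ i) : X ≃ᵢ X :=
  (isometry_limitFun 𝒰 hf hε g).isometryEquivOfCompactSpace

/-- Unfolding lemma for `limitMap`. [folklore] -/
theorem limitMap_apply (g : ∀ i, Γ i) (x : X) :
    limitMap 𝒰 hf hε g x = ulim 𝒰 fun i ↦ transport hf i (g i) x :=
  rfl

/-- UNIFORM CONVERGENCE `Tᵢ(gᵢ) → L(g)` ALONG `𝒰`: for every `δ > 0`, for `𝒰`-almost every `i`,
`d(Tᵢ(gᵢ) x, L(g) x) ≤ δ` for ALL `x` (pointwise convergence on a finite `δ/4`-net plus the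
uniform roughness bound `4εᵢ`). [folklore] -/
theorem eventually_forall_dist_transport_limitMap_le (g : ∀ i, Γ i) {δ : ℝ} (hδ : 0 < δ) :
    ∀ᶠ i in (𝒰 : Filter ℕ), ∀ x : X, dist (transport hf i (g i) x) (limitMap 𝒰 hf hε g x) ≤ δ := by
  obtain ⟨N, -, hNfin, hcover⟩ :=
    finite_cover_balls_of_compact (isCompact_univ (X := X)) (e := δ / 4) (by positivity)
  have h1 : ∀ᶠ i in (𝒰 : Filter ℕ), ∀ x' ∈ N,
      dist (transport hf i (g i) x') (limitMap 𝒰 hf hε g x') < δ / 4 :=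
    (eventually_all_finite hNfin).mpr fun x' _ ↦
      eventually_dist_ulim_lt 𝒰 (fun i ↦ transport hf i (g i) x') (by positivity)
  have h2 : ∀ᶠ i in (𝒰 : Filter ℕ), 4 * ε i < δ / 4 := eventually_const_mul_lt hε 4 (by positivity)
  filter_upwards [h1, h2] with i hi1 hi2 x
  obtain ⟨x', hx'N, hxx'⟩ : ∃ x' ∈ N, dist x x' < δ / 4 := by
    have hx := hcover (mem_univ x)
    simp only [mem_iUnion, mem_ball, exists_prop] at hx
    exact hx
  calc dist (transport hf i (g i) x) (limitMap 𝒰 hf hε g x)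
      ≤ dist (transport hf i (g i) x) (transport hf i (g i) x') +
          dist (transport hf i (g i) x') (limitMap 𝒰 hf hε g x') +
          dist (limitMap 𝒰 hf hε g x') (limitMap 𝒰 hf hε g x) := dist_triangle4 _ _ _ _
    _ ≤ (dist x x' + 4 * ε i) + δ / 4 + dist x' x := by
        gcongr
        · exact dist_transport_le hf i (g i) x x'
        · exact (hi1 x' hx'N).le
        · exact ((limitMap 𝒰 hf hε g).dist_eq x' x).le
    _ ≤ δ := by rw [dist_comm x' x]; linarith

/-! ### §4. The limit group -/

/-- `L(1) = 1`. [folklore] -/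
theorem limitMap_one : limitMap 𝒰 hf hε (1 : ∀ i, Γ i) = 1 := by
  refine IsometryEquiv.ext fun x ↦ ?_
  rw [limitMap_apply, IsometryEquiv.coe_one, id]
  apply ulim_eq_of_tendsto
  rw [tendsto_iff_dist_tendsto_zero]
  refine squeeze_zero (fun _ ↦ dist_nonneg) (fun i ↦ ?_) hε
  exact dist_transport_one_le hf i x

/-- `L(g g') = L(g) L(g')` for the pointwise product of threads. Proof:
`Tᵢ(gᵢ gᵢ') x ≈ Tᵢ(gᵢ)(Tᵢ(gᵢ') x) ≈ Tᵢ(gᵢ)(L(g') x)` uniformly (§2 and §3), and the `𝒰`-limit of the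
last expression is `L(g)(L(g') x)` by definition. [folklore] -/
theorem limitMap_mul (g g' : ∀ i, Γ i) :
    limitMap 𝒰 hf hε (g * g') = limitMap 𝒰 hf hε g * limitMap 𝒰 hf hε g' := by
  refine IsometryEquiv.ext fun x ↦ ?_
  rw [IsometryEquiv.mul_apply, limitMap_apply 𝒰 hf hε (g * g'), limitMap_apply 𝒰 hf hε g]
  apply ulim_eq_ulim_of_tendsto
  refine tendsto_zero_of_forall_eventually_le (fun _ ↦ dist_nonneg) fun δ hδ ↦ ?_
  have hU := eventually_forall_dist_transport_limitMap_le 𝒰 hf hε g' (half_pos hδ)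
  have h7 : ∀ᶠ i in (𝒰 : Filter ℕ), 7 * ε i < δ / 2 := eventually_const_mul_lt hε 7 (half_pos hδ)
  filter_upwards [hU, h7] with i hi h7i
  calc dist (transport hf i ((g * g') i) x) (transport hf i (g i) (limitMap 𝒰 hf hε g' x))
      ≤ dist (transport hf i (g i * g' i) x) (transport hf i (g i) (transport hf i (g' i) x)) +
          dist (transport hf i (g i) (transport hf i (g' i) x))
            (transport hf i (g i) (limitMap 𝒰 hf hε g' x)) := by
        rw [Pi.mul_apply]; exact dist_triangle _ _ _
    _ ≤ 3 * ε i + (dist (transport hf i (g' i) x) (limitMap 𝒰 hf hε g' x) + 4 * ε i) :=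
        add_le_add (dist_transport_mul_le hf i (g i) (g' i) x) (dist_transport_le hf i (g i) _ _)
    _ ≤ 3 * ε i + (δ / 2 + 4 * ε i) := by gcongr; exact hi x
    _ ≤ δ := by linarith

/-- `L(g⁻¹) = L(g)⁻¹`. [folklore] -/
theorem limitMap_inv (g : ∀ i, Γ i) : limitMap 𝒰 hf hε g⁻¹ = (limitMap 𝒰 hf hε g)⁻¹ :=
  eq_inv_of_mul_eq_one_left (by rw [← limitMap_mul, inv_mul_cancel, limitMap_one])

variable (Γ) in
/-- THE LIMIT GROUP `G ≤ Isom(X)` of the actions `Γᵢ ↷ Yᵢ` along `𝒰`: the set of limit isometries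
`L(g)` of all threads, a subgroup by `limitMap_one/mul/inv`. [folklore] -/
def limitGroup : Subgroup (X ≃ᵢ X) where
  carrier := range (limitMap (Γ := Γ) 𝒰 hf hε)
  one_mem' := ⟨1, limitMap_one 𝒰 hf hε⟩
  mul_mem' := by
    rintro _ _ ⟨g, rfl⟩ ⟨g', rfl⟩
    exact ⟨g * g', limitMap_mul 𝒰 hf hε g g'⟩
  inv_mem' := by
    rintro _ ⟨g, rfl⟩
    exact ⟨g⁻¹, limitMap_inv 𝒰 hf hε g⟩

variable (Γ) in
/-- Membership in the limit group. [folklore] -/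
theorem mem_limitGroup_iff (γ : X ≃ᵢ X) :
    γ ∈ limitGroup Γ 𝒰 hf hε ↔ ∃ g : ∀ i, Γ i, limitMap 𝒰 hf hε g = γ :=
  Iff.rfl

/-- Limit isometries belong to the limit group. [folklore] -/
theorem limitMap_mem (g : ∀ i, Γ i) : limitMap 𝒰 hf hε g ∈ limitGroup Γ 𝒰 hf hε :=
  (mem_limitGroup_iff Γ 𝒰 hf hε _).mpr ⟨g, rfl⟩

/-- LIMITS OF ABELIAN ACTIONS ARE ABELIAN ("Obviously, … `H` is Abelian", Huang–Huang–Wang–Zhu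
2026, §4 p. 13, for the limit of the deck groups `Hᵢ ≅ ℤᵇ`): if every `Γᵢ` is commutative then so
is the limit group, since `L(g) L(g') = L(g g') = L(g' g) = L(g') L(g)`.
[cite: HuangHuangWangZhu2026, §4 p. 13] -/
theorem limitGroup_mul_comm (hcomm : ∀ (i : ℕ) (a b : Γ i), a * b = b * a) {γ γ' : X ≃ᵢ X}
    (hγ : γ ∈ limitGroup Γ 𝒰 hf hε) (hγ' : γ' ∈ limitGroup Γ 𝒰 hf hε) : γ * γ' = γ' * γ := by
  obtain ⟨g, rfl⟩ := (mem_limitGroup_iff Γ 𝒰 hf hε γ).mp hγ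
  obtain ⟨g', rfl⟩ := (mem_limitGroup_iff Γ 𝒰 hf hε γ').mp hγ'
  rw [← limitMap_mul, ← limitMap_mul]
  congr 1
  funext i
  exact hcomm i (g i) (g' i)

/-! ### §5. Intrinsic characterization of the limit group; closedness -/

variable (Γ) in
/-- `γ ∈ Isom(X)` is APPROXIMABLE by the actions `Γᵢ` along `𝒰` if for every `δ > 0`, for
`𝒰`-almost every `i`, some transported element `Tᵢ(g)`, `g ∈ Γᵢ`, is uniformly `δ`-close to `γ`.
[folklore] -/
def IsApproximable (γ : X ≃ᵢ X) : Prop :=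
  ∀ δ : ℝ, 0 < δ → ∀ᶠ i in (𝒰 : Filter ℕ), ∃ g : Γ i, ∀ x : X, dist (transport hf i g x) (γ x) ≤ δ

/-- Limit isometries are approximable (by their own threads, §3). [folklore] -/
theorem isApproximable_limitMap (g : ∀ i, Γ i) : IsApproximable Γ 𝒰 hf (limitMap 𝒰 hf hε g) :=
  fun _ hδ ↦ (eventually_forall_dist_transport_limitMap_le 𝒰 hf hε g hδ).mono
    fun i hi ↦ ⟨g i, hi⟩

omit [∀ i, IsIsometricSMul (Γ i) (Y i)] [CompactSpace X] [Nonempty X] in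
/-- Approximability is closed under uniform approximation. [folklore] -/
theorem IsApproximable.of_forall_exists {γ : X ≃ᵢ X}
    (h : ∀ η : ℝ, 0 < η → ∃ γ' : X ≃ᵢ X, IsApproximable Γ 𝒰 hf γ' ∧ ∀ x, dist (γ' x) (γ x) ≤ η) :
    IsApproximable Γ 𝒰 hf γ := by
  intro δ hδ
  obtain ⟨γ', hγ', hdist⟩ := h (δ / 2) (half_pos hδ)
  filter_upwards [hγ' (δ / 2) (half_pos hδ)] with i ⟨g, hg⟩
  exact ⟨g, fun x ↦ (dist_triangle _ (γ' x) _).trans (by linarith [hg x, hdist x])⟩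

/-- Along a FREE ultrafilter, every approximable isometry is a limit isometry: choose `gᵢ ∈ Γᵢ`
realising the best accuracy `1/(n+1)`, `n ≤ i`, available at index `i` (`Nat.findGreatest`); then
`Tᵢ(gᵢ) → γ` uniformly along `𝒰`, so `L(g) = γ`. [folklore] -/
theorem IsApproximable.exists_limitMap_eq (h𝒰 : (𝒰 : Filter ℕ) ≤ atTop) {γ : X ≃ᵢ X}
    (hγ : IsApproximable Γ 𝒰 hf γ) : ∃ g : ∀ i, Γ i, limitMap 𝒰 hf hε g = γ := by
  classical
  -- accuracy levels
  let P : ℕ → ℕ → Prop := fun n i ↦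
    ∃ g : Γ i, ∀ x : X, dist (transport hf i g x) (γ x) ≤ 1 / ((n : ℝ) + 1)
  have hP : ∀ n, ∀ᶠ i in (𝒰 : Filter ℕ), P n i := fun n ↦ hγ _ (by positivity)
  let m : ℕ → ℕ := fun i ↦ Nat.findGreatest (fun n ↦ P n i) i
  let g : ∀ i, Γ i := fun i ↦ if h : P (m i) i then h.choose else 1
  have hg : ∀ n : ℕ, ∀ᶠ i in (𝒰 : Filter ℕ), ∀ x : X,
      dist (transport hf i (g i) x) (γ x) ≤ 1 / ((n : ℝ) + 1) := by
    intro n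
    have hn : ∀ᶠ i : ℕ in (𝒰 : Filter ℕ), n ≤ i := h𝒰 (eventually_ge_atTop n)
    filter_upwards [hP n, hn] with i hPi hni x
    have hle : n ≤ m i := Nat.le_findGreatest hni hPi
    have hPm : P (m i) i := Nat.findGreatest_spec (P := fun n ↦ P n i) hni hPi
    have hgi : g i = hPm.choose := dif_pos hPm
    rw [hgi]
    refine (hPm.choose_spec x).trans ?_
    have hle' : (n : ℝ) + 1 ≤ (m i : ℝ) + 1 := by exact_mod_cast Nat.add_le_add_right hle 1
    exact one_div_le_one_div_of_le (by positivity) hle'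
  refine ⟨g, IsometryEquiv.ext fun x ↦ ?_⟩
  rw [limitMap_apply]
  apply ulim_eq_of_tendsto
  rw [tendsto_iff_dist_tendsto_zero]
  refine tendsto_zero_of_forall_eventually_le (fun _ ↦ dist_nonneg) fun δ hδ ↦ ?_
  obtain ⟨n, hn⟩ := exists_nat_one_div_lt hδ
  filter_upwards [hg n] with i hi
  exact (hi x).trans hn.le

variable (Γ) in
/-- INTRINSIC CHARACTERIZATION: along a free ultrafilter, the limit group is exactly the set of
approximable isometries. [folklore] -/
theorem mem_limitGroup_iff_isApproximable (h𝒰 : (𝒰 : Filter ℕ) ≤ atTop) (γ : X ≃ᵢ X) :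
    γ ∈ limitGroup Γ 𝒰 hf hε ↔ IsApproximable Γ 𝒰 hf γ := by
  constructor
  · rintro ⟨g, rfl⟩
    exact isApproximable_limitMap 𝒰 hf hε g
  · intro h
    exact h.exists_limitMap_eq 𝒰 hf hε h𝒰

omit [Nonempty X] in
/-- Images of sets of isometric equivalences lie in `isometrySet X`. [folklore] -/
theorem image_toBCF_subset_isometrySet (S : Set (X ≃ᵢ X)) : toBCF '' S ⊆ isometrySet X := by
  rintro _ ⟨γ, -, rfl⟩
  exact γ.isometry

variable (Γ) in
/-- THE LIMIT GROUP IS CLOSED in `Isom(X)` for the topology of uniform convergence (its image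
under `toBCF : Isom(X) → (X →ᵇ X)` is closed): "`G` is a closed subgroup of `Isom(X)`"
(Huang–Huang–Wang–Zhu 2026, Thm 2.1). [cite: HuangHuangWangZhu2026, Thm 2.1] -/
theorem isClosed_image_toBCF_limitGroup (h𝒰 : (𝒰 : Filter ℕ) ≤ atTop) :
    IsClosed (toBCF '' (limitGroup Γ 𝒰 hf hε : Set (X ≃ᵢ X))) := by
  refine isClosed_of_closure_subset fun F hF ↦ ?_
  have hFiso : F ∈ isometrySet X :=
    closure_minimal (image_toBCF_subset_isometrySet _) (isClosed_isometrySet X) hF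
  rw [← range_toBCF] at hFiso
  obtain ⟨γ, rfl⟩ := hFiso
  refine ⟨γ, ?_, rfl⟩
  rw [SetLike.mem_coe, mem_limitGroup_iff_isApproximable Γ 𝒰 hf hε h𝒰]
  refine IsApproximable.of_forall_exists 𝒰 hf fun η hη ↦ ?_
  obtain ⟨F', ⟨γ', hγ'G, rfl⟩, hdist⟩ := Metric.mem_closure_iff.mp hF η hη
  refine ⟨γ', (mem_limitGroup_iff_isApproximable Γ 𝒰 hf hε h𝒰 γ').mp hγ'G, fun x ↦ ?_⟩
  have h1 := dist_apply_le_dist_toBCF γ' γ x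
  rw [dist_comm] at hdist
  exact h1.trans hdist.le

/-! ### §6. Every `Γᵢ` is eventually uniformly close to `G`, and conversely -/

variable (Γ) in
/-- For `𝒰`-almost every `i`, EVERY `g ∈ Γᵢ` has its transport uniformly `δ`-close to some element
of the limit group. (Otherwise choose bad `gᵢ` on a `𝒰`-large set; the thread's own limit `L(g) ∈ G`
is uniformly close to `Tᵢ(gᵢ)` along `𝒰` by §3 — contradiction.) [folklore] -/
theorem eventually_forall_exists_mem_limitGroup {δ : ℝ} (hδ : 0 < δ) :
    ∀ᶠ i in (𝒰 : Filter ℕ), ∀ g : Γ i, ∃ γ ∈ limitGroup Γ 𝒰 hf hε,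
      ∀ x : X, dist (transport hf i g x) (γ x) ≤ δ := by
  classical
  by_contra hcon
  rw [← Ultrafilter.eventually_not] at hcon
  let Bad : ∀ i, Γ i → Prop := fun i g ↦
    ∀ γ ∈ limitGroup Γ 𝒰 hf hε, ∃ x : X, δ < dist (transport hf i g x) (γ x)
  have hbad : ∀ᶠ i in (𝒰 : Filter ℕ), ∃ g : Γ i, Bad i g := by
    filter_upwards [hcon] with i hi
    simp only [not_forall, not_exists, not_and, not_le] at hi
    exact hi
  let g : ∀ i, Γ i := fun i ↦ if h : ∃ g : Γ i, Bad i g then h.choose else 1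
  have hg : ∀ᶠ i in (𝒰 : Filter ℕ), Bad i (g i) := by
    filter_upwards [hbad] with i hi
    have : g i = hi.choose := dif_pos hi
    rw [this]
    exact hi.choose_spec
  have hU := eventually_forall_dist_transport_limitMap_le 𝒰 hf hε g hδ
  obtain ⟨i, hi1, hi2⟩ := (hg.and hU).exists
  obtain ⟨x, hx⟩ := hi1 _ (limitMap_mem 𝒰 hf hε g)
  exact (not_lt.mpr (hi2 x)) hx

variable (Γ) in
/-- For `𝒰`-almost every `i`, EVERY element of the limit group is uniformly `δ`-close to the
transport of some `g ∈ Γᵢ` (finite `δ/2`-net of `G` — `G` is totally bounded in `X →ᵇ X`, being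
contained in the compact `isometrySet X` — and §3 on the net). [folklore] -/
theorem eventually_forall_mem_limitGroup_exists {δ : ℝ} (hδ : 0 < δ) :
    ∀ᶠ i in (𝒰 : Filter ℕ), ∀ γ ∈ limitGroup Γ 𝒰 hf hε, ∃ g : Γ i,
      ∀ x : X, dist (transport hf i g x) (γ x) ≤ δ := by
  have htb : TotallyBounded (toBCF '' (limitGroup Γ 𝒰 hf hε : Set (X ≃ᵢ X))) :=
    (isCompact_isometrySet X).totallyBounded.subset (image_toBCF_subset_isometrySet _)
  obtain ⟨t, htsub, htfin, hcover⟩ := finite_approx_of_totallyBounded htb (δ / 2) (half_pos hδ)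
  have h1 : ∀ᶠ i in (𝒰 : Filter ℕ), ∀ F ∈ t, ∃ g : Γ i,
      ∀ x : X, dist (transport hf i g x) (F x) ≤ δ / 2 := by
    refine (eventually_all_finite htfin).mpr fun F hF ↦ ?_
    obtain ⟨γ, hγ, rfl⟩ := htsub hF
    obtain ⟨g, rfl⟩ := (mem_limitGroup_iff Γ 𝒰 hf hε γ).mp hγ
    filter_upwards [eventually_forall_dist_transport_limitMap_le 𝒰 hf hε g (half_pos hδ)]
      with i hi
    exact ⟨g i, fun x ↦ by simpa only [toBCF_apply] using hi x⟩
  filter_upwards [h1] with i hi γ hγ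
  obtain ⟨F, hFt, hγF⟩ : ∃ F ∈ t, dist (toBCF γ) F < δ / 2 := by
    have h := hcover ⟨γ, hγ, rfl⟩
    simp only [mem_iUnion, mem_ball, exists_prop] at h
    exact h
  obtain ⟨g, hg⟩ := hi F hFt
  refine ⟨g, fun x ↦ ?_⟩
  calc dist (transport hf i g x) (γ x)
      ≤ dist (transport hf i g x) (F x) + dist (F x) (γ x) := dist_triangle _ _ _
    _ ≤ δ / 2 + δ / 2 := by
        refine add_le_add (hg x) ?_
        have h2 : dist (F x) (toBCF γ x) ≤ dist F (toBCF γ) := dist_coe_le_dist x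
        rw [toBCF_apply] at h2
        rw [dist_comm] at hγF
        exact h2.trans hγF.le
    _ = δ := by ring

/-! ### §7. Equivariant Gromov–Hausdorff convergence to the limit group -/

variable (Γ) in
/-- EQUIVARIANT CONVERGENCE ALONG `𝒰`: for every `δ > 0`, for `𝒰`-almost every `i`, the given
approximation `fᵢ : Yᵢ → X` extends to a `δ`-equivariant Gromov–Hausdorff approximation
`(fᵢ, φᵢ, ψᵢ)` from `Γᵢ ↷ Yᵢ` to `G ↷ X`, `G` the limit group. [cite: HuangHuangWangZhu2026, Thm 2.1
(Fukaya 1986; Fukaya–Yamaguchi 1992, Prop. 3.6), compact case] -/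
theorem eventually_exists_isEquivGHApprox {δ : ℝ} (hδ : 0 < δ) :
    ∀ᶠ i in (𝒰 : Filter ℕ), ∃ (φ : Γ i → limitGroup Γ 𝒰 hf hε) (ψ : limitGroup Γ 𝒰 hf hε → Γ i),
      IsEquivGHApprox δ (f i) φ ψ := by
  have hA := eventually_forall_exists_mem_limitGroup Γ 𝒰 hf hε (half_pos hδ)
  have hB := eventually_forall_mem_limitGroup_exists Γ 𝒰 hf hε (half_pos hδ)
  have hE : ∀ᶠ i in (𝒰 : Filter ℕ), 6 * ε i < δ := eventually_const_mul_lt hε 6 hδ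
  filter_upwards [hA, hB, hE] with i hiA hiB hiE
  choose φf hφmem hφ using hiA
  choose ψf hψ using hiB
  have hε0 : 0 ≤ ε i := eps_nonneg hf i
  refine ⟨fun g ↦ ⟨φf g, hφmem g⟩, fun γ ↦ ψf γ γ.2, (hf i).mono (by linarith), ?_, ?_⟩
  · intro g y
    change dist ((φf g) (f i y)) (f i (g • y)) ≤ δ
    calc dist ((φf g) (f i y)) (f i (g • y))
        ≤ dist ((φf g) (f i y)) (transport hf i g (f i y)) +
            dist (transport hf i g (f i y)) (f i (g • y)) := dist_triangle _ _ _
      _ ≤ δ / 2 + 3 * ε i := by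
          refine add_le_add ?_ (dist_transport_map_le hf i g y)
          rw [dist_comm]
          exact hφ g (f i y)
      _ ≤ δ := by linarith
  · intro γ y
    change dist ((γ : X ≃ᵢ X) (f i y)) (f i (ψf γ γ.2 • y)) ≤ δ
    calc dist ((γ : X ≃ᵢ X) (f i y)) (f i (ψf γ γ.2 • y))
        ≤ dist ((γ : X ≃ᵢ X) (f i y)) (transport hf i (ψf γ γ.2) (f i y)) +
            dist (transport hf i (ψf γ γ.2) (f i y)) (f i (ψf γ γ.2 • y)) := dist_triangle _ _ _
      _ ≤ δ / 2 + 3 * ε i := by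
          refine add_le_add ?_ (dist_transport_map_le hf i _ y)
          rw [dist_comm]
          exact hψ γ γ.2 (f i y)
      _ ≤ δ := by linarith

variable (Γ) in
/-- The same along a SUBSEQUENCE (for a free ultrafilter): there is a strictly increasing
`s : ℕ → ℕ` with `(f_{s n}, φₙ, ψₙ)` a `1/(n+1)`-equivariant approximation from `Γ_{s n} ↷ Y_{s n}`
to `G ↷ X` for every `n`. [cite: HuangHuangWangZhu2026, Thm 2.1, compact case] -/
theorem exists_strictMono_isEquivGHApprox (h𝒰 : (𝒰 : Filter ℕ) ≤ atTop) :
    ∃ s : ℕ → ℕ, StrictMono s ∧ ∀ n : ℕ,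
      ∃ (φ : Γ (s n) → limitGroup Γ 𝒰 hf hε) (ψ : limitGroup Γ 𝒰 hf hε → Γ (s n)),
        IsEquivGHApprox (1 / ((n : ℝ) + 1)) (f (s n)) φ ψ :=
  extraction_forall_of_frequently fun n ↦
    ((eventually_exists_isEquivGHApprox Γ 𝒰 hf hε
      (by positivity : (0 : ℝ) < 1 / ((n : ℝ) + 1))).frequently).filter_mono h𝒰

end Transport

/-! ### §8. The theorem in classical form -/

section Main

variable {X : Type*} [MetricSpace X] [CompactSpace X] [Nonempty X]
  {Y : ℕ → Type*} [∀ i, PseudoMetricSpace (Y i)]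
  {Γ : ℕ → Type*} [∀ i, Group (Γ i)] [∀ i, MulAction (Γ i) (Y i)] [∀ i, IsIsometricSMul (Γ i) (Y i)]
  {ε : ℕ → ℝ} {f : ∀ i, Y i → X}

/-- FUKAYA–YAMAGUCHI EQUIVARIANT PRECOMPACTNESS, COMPACT CASE (Huang–Huang–Wang–Zhu 2026, Thm 2.1:
"Let `(Xᵢ, pᵢ)` converge to `(X, p)` … `Gᵢ` closed subgroups of `Isom(Xᵢ)`. Then passing to a
subsequence, `(Xᵢ, pᵢ, Gᵢ) → (X, p, G)` where `G` is a closed subgroup of `Isom(X)`"), in the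
absolute form adequate for compact spaces and for arbitrary groups `Γᵢ` acting isometrically on
pseudometric spaces `Yᵢ`: if `fᵢ : Yᵢ → X` are `εᵢ`-Gromov–Hausdorff approximations of a compact
metric space `X` with `εᵢ → 0`, then there are a subgroup `G ≤ Isom(X)`, closed for uniform
convergence, and a subsequence `s` along which `(f_{s n}, φₙ, ψₙ)` are `1/(n+1)`-equivariant
Gromov–Hausdorff approximations `(Y_{s n}, Γ_{s n}) → (X, G)`.
[cite: HuangHuangWangZhu2026, Thm 2.1 (Fukaya 1986; Fukaya–Yamaguchi 1992, Prop. 3.6)] -/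
theorem exists_subgroup_strictMono_isEquivGHApprox (hf : ∀ i, IsGHApprox (ε i) (f i))
    (hε : Tendsto ε atTop (𝓝 0)) :
    ∃ G : Subgroup (X ≃ᵢ X), IsClosed (toBCF '' (G : Set (X ≃ᵢ X))) ∧
      ∃ s : ℕ → ℕ, StrictMono s ∧ ∀ n : ℕ, ∃ (φ : Γ (s n) → G) (ψ : G → Γ (s n)),
        IsEquivGHApprox (1 / ((n : ℝ) + 1)) (f (s n)) φ ψ := by
  have h𝒰 : ((hyperfilter ℕ : Ultrafilter ℕ) : Filter ℕ) ≤ atTop :=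
    hyperfilter_le_cofinite.trans_eq Nat.cofinite_eq_atTop
  have hε' : Tendsto ε ((hyperfilter ℕ : Ultrafilter ℕ) : Filter ℕ) (𝓝 0) := hε.mono_left h𝒰
  exact ⟨limitGroup Γ (hyperfilter ℕ) hf hε', isClosed_image_toBCF_limitGroup Γ _ hf hε' h𝒰,
    exists_strictMono_isEquivGHApprox Γ _ hf hε' h𝒰⟩

/-- … "MOREOVER, THE QUOTIENT SPACES CONVERGE": along the same subsequence the induced maps of
orbit spaces `Y_{s n}/Γ_{s n} → X/G` are `3/(n+1)`-Gromov–Hausdorff approximations for the orbit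
pseudometrics (`IsEquivGHApprox.isGHApprox_orbitMap`).
[cite: HuangHuangWangZhu2026, Thm 2.1 ("Moreover")] -/
theorem exists_subgroup_strictMono_isGHApprox_orbitMap (hf : ∀ i, IsGHApprox (ε i) (f i))
    (hε : Tendsto ε atTop (𝓝 0)) :
    ∃ G : Subgroup (X ≃ᵢ X), IsClosed (toBCF '' (G : Set (X ≃ᵢ X))) ∧
      ∃ s : ℕ → ℕ, StrictMono s ∧ ∀ n : ℕ,
        (∃ (φ : Γ (s n) → G) (ψ : G → Γ (s n)),
          IsEquivGHApprox (1 / ((n : ℝ) + 1)) (f (s n)) φ ψ) ∧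
        IsGHApprox (3 * (1 / ((n : ℝ) + 1))) (orbitMap (Γ (s n)) G (f (s n))) := by
  obtain ⟨G, hG, s, hs, h⟩ := exists_subgroup_strictMono_isEquivGHApprox (Γ := Γ) hf hε
  refine ⟨G, hG, s, hs, fun n ↦ ⟨h n, ?_⟩⟩
  obtain ⟨φ, ψ, hφψ⟩ := h n
  exact hφψ.isGHApprox_orbitMap

end Main

section FromGHDist

variable {X : Type*} [MetricSpace X] [CompactSpace X] [Nonempty X]
  {Y : ℕ → Type*} [∀ i, MetricSpace (Y i)] [∀ i, CompactSpace (Y i)] [∀ i, Nonempty (Y i)]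
  {Γ : ℕ → Type*} [∀ i, Group (Γ i)] [∀ i, MulAction (Γ i) (Y i)] [∀ i, IsIsometricSMul (Γ i) (Y i)]

/-- The theorem starting from Gromov–Hausdorff convergence `d_GH(Yᵢ, X) → 0` of nonempty compact
metric spaces in Mathlib's sense (`GromovHausdorff.ghDist`): approximations `fᵢ : Yᵢ → X` are
produced by `exists_isGHApprox_of_ghDist_lt` and the limit group and subsequence by
`exists_subgroup_strictMono_isEquivGHApprox`. [cite: HuangHuangWangZhu2026, Thm 2.1
(Fukaya 1986; Fukaya–Yamaguchi 1992, Prop. 3.6), compact case] -/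
theorem exists_subgroup_strictMono_isEquivGHApprox_of_tendsto_ghDist
    (h : Tendsto (fun i ↦ GromovHausdorff.ghDist (Y i) X) atTop (𝓝 0)) :
    ∃ (f : ∀ i, Y i → X) (G : Subgroup (X ≃ᵢ X)), IsClosed (toBCF '' (G : Set (X ≃ᵢ X))) ∧
      ∃ s : ℕ → ℕ, StrictMono s ∧ ∀ n : ℕ, ∃ (φ : Γ (s n) → G) (ψ : G → Γ (s n)),
        IsEquivGHApprox (1 / ((n : ℝ) + 1)) (f (s n)) φ ψ := by
  have hlt : ∀ i : ℕ, GromovHausdorff.ghDist (Y i) X <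
      GromovHausdorff.ghDist (Y i) X + 1 / ((i : ℝ) + 1) := fun i ↦
    lt_add_of_pos_right _ (by positivity)
  choose f hf using fun i ↦ exists_isGHApprox_of_ghDist_lt (Y i) X (hlt i)
  have hε : Tendsto (fun i : ℕ ↦ 2 * (GromovHausdorff.ghDist (Y i) X + 1 / ((i : ℝ) + 1)))
      atTop (𝓝 0) := by
    simpa using (h.add tendsto_one_div_add_atTop_nhds_zero_nat).const_mul 2
  obtain ⟨G, hG, hs⟩ := exists_subgroup_strictMono_isEquivGHApprox (Γ := Γ) hf hε
  exact ⟨f, G, hG, hs⟩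

end FromGHDist

end Literature.Geometry.MetricGeometry

end
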